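import Summits.QuantumFields.YangMills.Theorems.BalabanUVNodesN11AllStepsQuadSlot

/-!
# DAG node N11 — THE 𝐓-LAWS OF THE RECORD DO NOT FORCE A SINGLE EFFECTIVE-ACTION TERM: the 𝐓-image term laws `Sect2.LawsT … k` hold for the ZERO term values (no `𝐄`, `𝐑`, `𝐁`) under the
# RG equations of the run (true by construction) and the signs, so the companion's «every 𝐓-law modulo supports» specialises to ZERO terms — next to every `θ`, inside K1⁹'s hypothesis
# class, `TLaw₁₃CoPH θ′ p k` for every `k` from the per-child SUPPORT conditions, the signs `0 ≤ E₀, B₀` and nonnegative couplings alone (count-neutral, LOCATED; nothing of Bałaban)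

HEADER — WORK-UNIT METADATA.  Cell `pub-ymgap`, YM-PLAN Track A (HUMAN RULING D-0062), seat `pub-ymgap-dag-n11-d` (g34; N11 [B14], s2), route `BalabanUVNodes`, item K1⁹ =
stmt-QuantumFields-27364 (helper lane, `--kind proof --supports 27364 --as helper`, count-neutral).  [III] = [Balaban1988Convergent], [I] = [Balaban1987RG1].  Over this seat's
`…N11AllStepsQuadSlot` (g34: ★★★★★ `exists_zh_allSteps_tLaw_of_supports` ∕ `…_of_hypotheses`), 11c `Node00/Sect2FormOfRecord` (`Sect2.LawsT = LFHyp k ∧ LFNewTerms k ∧ LFHypAnalytic (k+1)`,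
`Sect2.lawsRT_towerOfTerms_zero`, `Sect2.TermValues.zero`), r11 `Step` (`LFNewTerms`, `LFHypImproved`), RECORD 13 (`settingOfRecord₁₃_satisfiesRG` — the run's flow satisfies (0.20) at every
step by construction; `(settingOfRecord₁₃ …).lf = θ.s2.lf`, `.flow.g = gOfRecord₁₃ … p` by `rfl`).

WHY ∕ WHAT.  The companion leaves the term laws (iii) as a displayed hypothesis for prescribed terms; here they are DISCHARGED for the zero term values.  §1 ★ `lawsT_towerOfTerms_zero`
(generic: `Sect2.LawsT (towerOfTerms S Rz M Ω 0-terms) S.lf S.βc k` from `S.flow.SatisfiesRG (k+1)`, `0 ≤ E₀`, `0 ≤ B₀`, `0 ≤ g_j` (`j ≤ k+1`) — old-term laws and analyticity by 11c's lemma,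
the new-term clauses trivial for `0`, the improved bounds `‖0‖ ≤` a nonnegative right-hand side) · `lawsT_sect2TowerOfRecord_zero` (at the record, along every run and history).  §2 ★★★★★
`exists_zh_allSteps_tLaw_zeroTerms_of_supports` · ★★★★★ `…_of_hypotheses`: next to every `θ` (resp. inside K1⁹'s hypothesis class) a `θ′` with, for every run and EVERY step `k`:
signs + nonnegative couplings + (i) `0 ≤ 𝐓ρ_k` + (ii) per child a.e. on the `χ_{k+1}(s)`-support «`0 < (𝐓ρ_k)(s) → 0 < J⁰_p(s)`» (`J⁰` = `θ`'s own new side with ZERO terms and the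
generation-`k` residual factor set to `1`) ⟹ `TLaw₁₃CoPH θ′ p k`.  READING (type owners def-T ∕ K0b ∕ RR-2; director's column next to RR-2's LOCATED-QUAD 2026-08-29T15:20:20Z): absent a law
tying `quad` to the fluctuation variables, the 𝐓-side of the record is met WITHOUT ANY renormalization term wherever the supports allow — [III] Thm 1 ∕ Thm 2's content (the terms and
their bounds) is invisible to the record's 𝐓-laws until `quad` (C2) and `ζ0` (K0b) are pinned.

HONEST FRAMING.  A READING on the tree's own rows and objects (count-neutral, LOCATED): nothing of Bałaban asserted or refuted; the support conditions (ii) are NOT claimed at any `θ`;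
K1⁹'s `∃θ` NOT advanced and NOT refuted (𝐒-laws, 𝐑-steps, consequent faces untouched); no `Stage13HParams` of record constructed or modified; N11 NOT discharged; K1⁹ NOT closed; no
registered stub touched; counts unmoved (typed 28∕28 · discharged 8∕27).  One finite four-torus programme at fixed `ε = L^{−K}`; NOT ℝ⁴, NOT OS, NOT a mass gap, NOT Clay.  No `sorry`,
`axiom`, `def`, `instance`, `notation`.  Sources (SHAPE only): [III] Thm 1 p.262, remark p.262, §2 p.262, (2.18) p.257, (2.21)–(2.23) p.258, (2.27)–(2.31) pp.259–260, (2.42) p.261,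
(3.2)–(3.9) pp.265–266, (3.23)–(3.25) p.270, §3 p.279; [I] (0.20) p.256.
-/

noncomputable section

open MeasureTheory
open scoped BigOperators Matrix.Norms.L2Operator

namespace Summit.QuantumFields.YangMills.Theorems.BalabanUVNodesN11AllStepsQuadSlotZeroTerms

open Literature.MathematicalPhysics.QuantumFieldTheory.Balaban1983to89 T4Continuum Node00 Node00.Tk B14.Eq218Concrete B14.Sect3Decomp
open BalabanUVNodesN11AllStepsQuadSlot (exists_zh_allSteps_tLaw_of_supports exists_zh_allSteps_tLaw_of_supports_of_hypotheses)

variable {F : T4Family} {N : ℕ} [NeZero N]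

/-! ## §1. The 𝐓-image term laws hold for the ZERO term values (no `𝐄`, `𝐑`, `𝐁` at all) under the RG equations and the signs -/

section ZeroTerms

variable {P : Params} {𝔸 : Type*} [NormedRing 𝔸] [NormedAlgebra ℂ 𝔸] [CompleteSpace 𝔸] {G : Type*} [GaugeGroup G] {V : Type*}

/-- ★ **THE 𝐓-IMAGE LAWS `Sect2.LawsT … k` HOLD FOR THE ZERO TERM VALUES** (no renormalization terms at all): old-term laws and analyticity from 11c's `lawsRT_towerOfTerms_zero`, the new-term
clauses — RG equation of the flow at step `k`, locality ∕ gauge invariance (trivial for `0`), improved bounds (`‖0‖ ≤` a nonnegative right-hand side) — under `Flow.SatisfiesRG (k+1)`, `0 ≤ E₀`,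
`0 ≤ B₀` and nonnegative couplings up to `k+1`. [cite: Balaban1988Convergent, §2 p.262, (2.27)–(2.31) pp.259–260, (2.42) p.261, §3 p.279; Balaban1987RG1, (0.20) p.256] -/
theorem lawsT_towerOfTerms_zero (S : Sect2.Setting 𝔸 G) (Rz : Sect2.Residual P 𝔸) (M : ℕ) (Ω : ℕ → Set (Site P 0)) (k : ℕ) (hrg : S.flow.SatisfiesRG (k + 1))
    (hE₀ : 0 ≤ S.lf.E₀) (hB₀ : 0 ≤ S.lf.B₀) (hg : ∀ j, j ≤ k + 1 → 0 ≤ S.flow.g j) :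
    Sect2.LawsT (Sect2.towerOfTerms S Rz M Ω (Sect2.TermValues.zero (V := V))) S.lf S.βc k := by
  refine ⟨(Sect2.lawsRT_towerOfTerms_zero (V := V) S Rz M Ω k (fun j hj => hrg j (Nat.lt_succ_of_lt hj)) hE₀ hB₀ fun j hj => hg j (Nat.le_succ_of_le hj)).1,
    ⟨hrg k (Nat.lt_succ_self k), fun _ _ _ _ _ _ => rfl, fun _ _ _ _ => rfl, fun _ _ _ _ _ => rfl, fun _ _ _ => rfl, ⟨fun _ X z g φ _ _ _ => ?_, fun _ X φ _ => ?_,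
      fun _ X φ a _ => ?_⟩⟩, (Sect2.lawsRT_towerOfTerms_zero (V := V) S Rz M Ω (k + 1) hrg hE₀ hB₀ hg).2⟩
  · show ‖(0 : ℂ)‖ ≤ _
    rw [norm_zero]
    exact mul_nonneg hE₀ (Real.exp_nonneg _)
  · show ‖(0 : ℂ)‖ ≤ _
    rw [norm_zero]
    exact mul_nonneg (pow_nonneg (hg (k + 1) le_rfl) _) (Real.exp_nonneg _)
  · show ‖(0 : ℂ)‖ ≤ _
    rw [norm_zero]
    exact mul_nonneg hB₀ (Real.exp_nonneg _)

/-- … hence at the record: along every run `p`, for every history `s` and step `k`, the ZERO term values obey the 𝐓-image laws of the ₁₃ setting under the signs `0 ≤ E₀`, `0 ≤ B₀` and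
nonnegative couplings of the run up to `k+1` (the RG equations hold along the run by construction, `settingOfRecord₁₃_satisfiesRG`). [cite: Balaban1988Convergent, §2 p.262, §3 p.279; Balaban1987RG1, (0.20) p.256] -/
theorem lawsT_sect2TowerOfRecord_zero (θ : Stage13HParams F N) (p : B12.RunParams) {n : ℕ} (s : SeqOfRecord F θ.ν θ.τ9.M (gOfRecord₁₃ F N θ.toStage13Params p) p.K n) (k : ℕ)
    (hE₀ : 0 ≤ θ.s2.lf.E₀) (hB₀ : 0 ≤ θ.s2.lf.B₀) (hg : ∀ j, j ≤ k + 1 → 0 ≤ gOfRecord₁₃ F N θ.toStage13Params p j) :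
    Sect2.LawsT (sect2TowerOfRecord F N (FluctV N) p.K (settingOfRecord₁₃ F N θ.toStage13Params p) (θ.rzAt p s) s Sect2.TermValues.zero)
      (settingOfRecord₁₃ F N θ.toStage13Params p).lf (settingOfRecord₁₃ F N θ.toStage13Params p).βc k :=
  lawsT_towerOfTerms_zero _ _ _ _ k (settingOfRecord₁₃_satisfiesRG F N θ.toStage13Params p (k + 1)) hE₀ hB₀ hg

end ZeroTerms

/-! ## §2. Every 𝐓-law of the record with NO renormalization terms, modulo supports -/

section Fiat

/-- ★★★★★ **WITH ZERO TERMS — no `𝐄`, no `𝐑`, no `𝐁`, any constants `e_p` — EVERY 𝐓-LAW OF THE RECORD HOLDS MODULO SUPPORTS NEXT TO EVERY `θ`**: there is a parameter `θ′` with the SAME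
`Stage13RParams` data and `Phih` as `θ` (residuals unchanged below the top generation of each history length; rows `zhLocal` ∕ `zhLaws` ∕ `ZhUnity` transferred) such that for every run `p`
and EVERY step `k`, under the signs `0 ≤ E₀`, `0 ≤ B₀` and nonnegative couplings `g_0, …, g_{k+1}` of the run: (i) `0 ≤ 𝐓ρ_k(s)` ∧ (ii) per child `s` of length `k+1`, a.e. on the support of
`χ_{k+1}(s)`, «`0 < (𝐓ρ_k)(s)(V) → 0 < J⁰_p(s)(V)`» — `J⁰_p(s)` = `θ`'s own new side at `s` with ZERO terms, constant `e_p` and the generation-`k` residual factor set to `1` — ⟹ `TLaw₁₃CoPH θ′ p k`.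
So, absent a law tying `quad` to the fluctuation variables, the 𝐓-laws of the record do not even force the presence of an effective-action term: what they ask of a K1⁹ witness is the
family of support conditions (ii).  LOCATED, count-neutral; nothing of Bałaban asserted or refuted; (ii) NOT claimed at any `θ`; K1⁹'s `∃θ` neither advanced nor refuted.
[cite: Balaban1988Convergent, Thm 1 p.262, remark p.262, (2.18) p.257, (2.21)–(2.23) p.258, (3.23)–(3.25) p.270, Def. p.279; Balaban1987RG1, (0.20) p.256] -/
theorem exists_zh_allSteps_tLaw_zeroTerms_of_supports (θ : Stage13HParams F N) (e : B12.RunParams → ℝ) :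
    ∃ θ' : Stage13HParams F N, θ'.toStage13RParams = θ.toStage13RParams ∧ θ'.Phih = θ.Phih ∧
      (∀ p n Ω Λ j Y ω, j + 1 ≠ n → (θ'.Zh p n Ω Λ).ζ0 j Y ω = (θ.Zh p n Ω Λ).ζ0 j Y ω) ∧
      (∀ p n Ω Λ j Λ' ω, j + 1 ≠ n → (θ'.Zh p n Ω Λ).quad j Λ' ω = (θ.Zh p n Ω Λ).quad j Λ' ω) ∧
      ((∀ p n Ω Λ, (θ.Zh p n Ω Λ).LocalLaws) → ∀ p n Ω Λ, (θ'.Zh p n Ω Λ).LocalLaws) ∧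
      ((∀ p n Ω Λ, (θ.Zh p n Ω Λ).Laws) → ∀ p n Ω Λ, (θ'.Zh p n Ω Λ).Laws) ∧
      (θ.ZhUnity → θ'.ZhUnity) ∧
      ∀ (p : B12.RunParams) (k : ℕ), 0 ≤ θ.s2.lf.E₀ → 0 ≤ θ.s2.lf.B₀ → (∀ j, j ≤ k + 1 → 0 ≤ gOfRecord₁₃ F N θ.toStage13Params p j) →
        (∀ (s : SeqOfRecord F θ.ν θ.τ9.M (gOfRecord₁₃ F N θ.toStage13Params p) p.K (k + 1)) (V : GaugeField (F.P p.K) (k + 1) (SU N)),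
          0 ≤ slotsTOfRecord F N θ.ν θ.τ9 (EOfRecord₁₃ F N θ.toStage13Params) (wOfRecord₉ F N θ.toStage9Params) θ.ppSel p (gOfRecord₁₃ F N θ.toStage13Params p) (k + 1) s V) →
        (∀ s : SeqOfRecord F θ.ν θ.τ9.M (gOfRecord₁₃ F N θ.toStage13Params p) p.K (k + 1),
          ∀ᵐ V ∂fieldMeasure (F.P p.K) (k + 1) (SU N), chiSeqOfRecord F N θ.ν θ.τ9.M (gOfRecord₁₃ F N θ.toStage13Params p) p.K (k + 1) s V ≠ 0 →
            0 < slotsTOfRecord F N θ.ν θ.τ9 (EOfRecord₁₃ F N θ.toStage13Params) (wOfRecord₉ F N θ.toStage9Params) θ.ppSel p (gOfRecord₁₃ F N θ.toStage13Params p) (k + 1) s V →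
            0 < sect2Slot F N (FluctV N) p.K (settingOfRecord₁₃ F N θ.toStage13Params p) (θ.rzAt p s)
              { WtOfRecord₁₃H F N θ p s with ζ := fun j Y ω => if j = k then 1 else (WtOfRecord₁₃H F N θ p s).ζ j Y ω } s Sect2.TermValues.zero (e p)
              (UbgOfRecord₁₃CoP F N θ.toStage13Params p (k + 1) s) V) →
        TLaw₁₃CoPH F N θ' p k := by
  obtain ⟨θ', h1, h2, hζoff, hqoff, hloc, hlaws, hun, htl⟩ := exists_zh_allSteps_tLaw_of_supports θ (fun _ _ => Sect2.TermValues.zero) e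
  exact ⟨θ', h1, h2, hζoff, hqoff, hloc, hlaws, hun, fun p k hE₀ hB₀ hg hT0 hJ =>
    htl p k hT0 hJ fun s => lawsT_sect2TowerOfRecord_zero θ p s k hE₀ hB₀ hg⟩

/-- ★★★★★ **… AND INSIDE K1⁹'s HYPOTHESIS CLASS**: from ANY `θ` with K1⁹'s four hypothesis-side conjuncts, a `θ′` WITH THE SAME FOUR at which, for every run `p` and EVERY step `k`, the
signs, the nonnegative couplings and the per-child support conditions (ii) at ZERO terms ALONE give `TLaw₁₃CoPH θ′ p k`. [cite: Balaban1988Convergent, Thm 1 p.262, remark p.262, (2.18) p.257, (3.2)–(3.9) pp.265–266, (3.23)–(3.25) p.270, Def. p.279; Balaban1987RG1, (0.20) p.256] -/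
theorem exists_zh_allSteps_tLaw_zeroTerms_of_supports_of_hypotheses (θ : Stage13HParams F N) (hP : θ.Provisos₁₃SepCoPH F N) (hU : θ.ZhUnity)
    (hS : θ.SlotsNondegenerate₁₃ F N) (hA : θ.Admissible F N) (e : B12.RunParams → ℝ) :
    ∃ θ' : Stage13HParams F N, θ'.toStage13RParams = θ.toStage13RParams ∧ θ'.Phih = θ.Phih ∧
      (∀ p n Ω Λ j Y ω, j + 1 ≠ n → (θ'.Zh p n Ω Λ).ζ0 j Y ω = (θ.Zh p n Ω Λ).ζ0 j Y ω) ∧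
      (∀ p n Ω Λ j Λ' ω, j + 1 ≠ n → (θ'.Zh p n Ω Λ).quad j Λ' ω = (θ.Zh p n Ω Λ).quad j Λ' ω) ∧
      θ'.Provisos₁₃SepCoPH F N ∧ (θ'.ZhUnity ∧ θ'.SlotsNondegenerate₁₃ F N) ∧ θ'.Admissible F N ∧
      ∀ (p : B12.RunParams) (k : ℕ), 0 ≤ θ.s2.lf.E₀ → 0 ≤ θ.s2.lf.B₀ → (∀ j, j ≤ k + 1 → 0 ≤ gOfRecord₁₃ F N θ.toStage13Params p j) →
        (∀ s : SeqOfRecord F θ.ν θ.τ9.M (gOfRecord₁₃ F N θ.toStage13Params p) p.K (k + 1),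
          ∀ᵐ V ∂fieldMeasure (F.P p.K) (k + 1) (SU N), chiSeqOfRecord F N θ.ν θ.τ9.M (gOfRecord₁₃ F N θ.toStage13Params p) p.K (k + 1) s V ≠ 0 →
            0 < slotsTOfRecord F N θ.ν θ.τ9 (EOfRecord₁₃ F N θ.toStage13Params) (wOfRecord₉ F N θ.toStage9Params) θ.ppSel p (gOfRecord₁₃ F N θ.toStage13Params p) (k + 1) s V →
            0 < sect2Slot F N (FluctV N) p.K (settingOfRecord₁₃ F N θ.toStage13Params p) (θ.rzAt p s)
              { WtOfRecord₁₃H F N θ p s with ζ := fun j Y ω => if j = k then 1 else (WtOfRecord₁₃H F N θ p s).ζ j Y ω } s Sect2.TermValues.zero (e p)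
              (UbgOfRecord₁₃CoP F N θ.toStage13Params p (k + 1) s) V) →
        TLaw₁₃CoPH F N θ' p k := by
  obtain ⟨θ', h1, h2, hζoff, hqoff, hP', hUS, hA', htl⟩ := exists_zh_allSteps_tLaw_of_supports_of_hypotheses θ hP hU hS hA (fun _ _ => Sect2.TermValues.zero) e
  exact ⟨θ', h1, h2, hζoff, hqoff, hP', hUS, hA', fun p k hE₀ hB₀ hg hJ => htl p k hJ fun s => lawsT_sect2TowerOfRecord_zero θ p s k hE₀ hB₀ hg⟩

end Fiat


end Summit.QuantumFields.YangMills.Theorems.BalabanUVNodesN11AllStepsQuadSlotZeroTerms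

end
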